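import Literature.MathematicalPhysics.QuantumFieldTheory.Balaban1983to89.B9SectCDiffDict
import Literature.MathematicalPhysics.QuantumFieldTheory.Balaban1983to89.B9SectCDiffFrame

/-!
# `Balaban1983to89.B9SectCDiffAssembly` — hypothesis (M) of THEOREM D from the typed conclusion of B9
Corollary 3.6 ALONG A POSITION MAP, the (3.48) dictionary for `C = (Q′G′²Q′*)⁻¹`, and the ASSEMBLER of
`EstHyp` from per-sequence parts (item (T1c)(c)(iv) of the cell brief `b2b-balaban-r1/g11/BRIEF-gen12.md`)

B9 = T. Bałaban, *Propagators for lattice gauge theories in a background field*, Commun. Math. Phys. **99**, 389–434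
(1985) [Balaban1985BackgroundPropagators]; [4] = B6 = T. Bałaban, *Propagators and renormalization transformations
for lattice gauge theories. II*, Commun. Math. Phys. **96**, 223–250 (1984) [Balaban1984PropagatorsII].

CITATION HEADER (lean-in-tree rule 2026-08-18).  Cell `pub-balaban`, unit `b2b-balaban-r1-g12` (READER GROUP A,
lineage r1, gen 12), journal claim `SECTC-DIFF-ASSEMBLY`.  Source: doi:10.1007/bf01240355, held
`paper:balaban1985-cmp99-background-propagators`, journal page = PDF page + 388.  Renders READ AS IMAGES by this unit
(`run/shared/lean/pub/pub-balaban/b2b-balaban-ref1/pages/1985-cmp99-background-propagators/…-pNNN-x2.png`):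
p. 398 [PDF 10] — Theorem 3.2 (3.48) *"|(Q′(U)G′²(U)Q′*(U))^{−1}(y, y′)| ≤ B₀(L^jη)^{−4}(L^{j′}η)^{−d}e^{−δ₀d(y,y′)},
y, y′ ∈ 𝔅 (y ∈ Λ_j, y′ ∈ Λ_{j′})"* and the two remarks after Theorem 3.1, *"the choice of derivatives ∇_U, ∇*_U is
conventional, we may always replace ∇_U by ∇*_U, and vice versa, in arbitrary place and combination"* and *"Using
Lemma 2.1 in [4] we may replace the factor (L^jη)^α by (L^jη)^β(L^{j′}η)^γ with β + γ = α, j, j′ are indices of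
localizations"* (the printed licence for the scale TRANSFER of §1); p. 399 [PDF 11] — Theorem 3.3 *"with G′(U)
replaced by G(U) and λ replaced by a function J defined at bonds of the lattice T_η, or Ω₀, and with values in 𝔤"*;
p. 408 [PDF 20] — Corollary 3.6 *"then Theorems 3.1–3.3 hold for the operators G′(U), (Q′(U)G′²(U)Q′*(U))^{−1}, G(U)
constructed for the sequence {Ω′_j}"*; p. 414 [PDF 26] — *"They are of the order O(M⁻¹), or O(M⁻²), if considered
on a proper scale"*.  Tree inputs (by name): `B9.Geometry`, `B9.Backgrounds`, `B9.KernelFamily`, `B9.SiteKernel`,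
`B9.Ineq342_346_347`, `B9.Thms31to33IneqAt` (b09 lineage); `B9SectCDiffEstimate.{BlkMaj, WDec, Frame, OpDec,
OpZon, EstHyp, EstHyp.core_diff_entry}`, `B9SectCDiffDict.{Realizes, kpow, maj342, blkMaj_of_ineq342}`,
`B9SectCDiffFrame.{geoFrame, profileW, geo_core_diff_entry}` (this lineage); `B6DomainChange.Profile`,
`B6DomainMajorant.zoneDepth`.  Cell rows: GAPS G-B9-05R residual (iv) (instantiation of `EstHyp`), this module's row
C-r1g12-1, the per-field instantiation census `b2b-balaban-r1/SectC-inst-census.md`.  Mathlib otherwise.  No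
`HarnessLib` fact, no named-fact `Prop`; the only new predicates are HYPOTHESIS structures (`RealizesKer`, `MOne`,
`MTwo`, `LDat`); no `sorry`.  v1.1 (same unit): APPEND-ONLY `core_dE_entry_of_parts` (the E-twin of THEOREM D's
conclusion from the parts, for b09's (3.97) consumer) + the docstring of `opDec_DtG_of_trace` now quotes the PRINTED trace
identity (3.8) p. 392 [PDF 4] (render `…-p004-x2.png` read as an image): *"(D*A)(x) = Σ_{μ=1}^{d} η^{−1}(R(U(x, x − ηe_μ))
A(x − ηe_μ, x) − A(x, x + ηe_μ)) = Σ_{μ=1}^{d} (D*_μ A_μ)(x) = Σ_{μ=1}^{d} (DA_μ)(x, x − ηe_μ)"*; no v1 declaration changed.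

## WHAT THIS MODULE DOES

THEOREM D (`…B9SectCDiffEstimate`) bounds the defect of two LOCAL multiscale propagator systems from hypotheses
(M) (sixteen one-sequence factors in classes `𝒟(0, k, c)`), (L), (P) over ONE frame `F` on a carrier `S` (for B9:
the global block lattice with the distance `d` of [4] (2.46), `…B9SectCDiffFrame.geoFrame`).  The two local
sequences `{Ω_n(□₁)}`, `{Ω_n(□₂)}` have their OWN block lattices `𝔅(□₁)`, `𝔅(□₂)` (the `g.Site` of two
`B9.Geometry`s), on which Corollary 3.6 gives Theorems 3.1–3.3 with the LOCAL distances `d_□`; they sit in `S` by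
POSITION MAPS `p_c : 𝔅(□_c) → S` (the `p₁`, `p₂` of `EstHyp`).  `…B9SectCDiffDict.opDec_of_ineq342` treats only
`S = 𝔅(□)`, `p = id`, which cannot serve both sequences at once.  Here:
* §1 `opDec_mono` (the class is monotone in the constant) and `OpDec.lmul_local`: LEFT multiplication by a LOCAL
  operator (block majorant with row sums `≤ m` and block range `≤ r`) maps `𝒟(n, k, c)` to
  `𝒟(n, k, m·Λ·e^{(u+δ₀−nu)r}·c)` — one (2.60)-transfer of the scale weight plus the triangle inequality;
* §2 `opDec_of_ineq342_along`: (3.42) for a kernel family on `𝔅(□)` + a realization of `T` + a position map that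
  PRESERVES THE SCALE (`F.sc (p y) = Lʲη`) and COMPARES DISTANCES AT THE FRAME'S RATE (`F.δ₀·F.ρ(p y, p y′) ≤
  δ₀·d_□(y, y′)`; `cmp_of_le`: e.g. `F.δ₀ ≤ δ₀` and `F.ρ ∘ p ≤ d_□`, the in-zone case `m = 1` of the cell's
  `B9SectCDistCompare` bond covers) ⇒ `T ∈ 𝒟(0, k_n, B₀)` with positions `p`;
* §3 `RealizesKer` + `opDec_of_ineq348_along`: the printed (3.48) bounds the KERNEL of `C` with respect to the
  block-lattice measure; the matrix of the action on functions carries the column weight `(L^{j′}η)^d`, which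
  cancels the printed `(L^{j′}η)^{−d}` (reading of the cell XREAD b09-g9 N1) ⇒ `C ∈ 𝒟(0, −4, κB₁)`;
* §4 the bundles `MOne` (7 fields of sequence 1), `MTwo` (9 fields of sequence 2), `LDat` ((L): 7 zone fields, 3
  one-sided forms, 6 coefficient operators) and the ASSEMBLER `assemble : MOne c₁ → MTwo c₂ → LDat θ → (P) → EstHyp`
  with `c = max(1, c₁, c₂)`; `core_diff_entry_of_parts` = THEOREM D's conclusion from the parts (v1.1: and its E-twin
  `core_dE_entry_of_parts` for `E = Q′G′²Q′*` of (3.97), via `EstHyp.core_dE_entry`);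
* §5 `MOne.of_thms31to33` / `MTwo.of_thms31to33`: the typed conclusion of Corollary 3.6 for ONE sequence at `U`
  (`B9.Thms31to33IneqAt d Gp GA Cinv A₀ δ₀ Bβ Bε Bεβ A₁ δ₁ U`) + realizations of `G′, ∂G′, G, ∇G` (entries 0, 1 of
  `Gp`, `GA`) and of `C` (`RealizesKer`) + the averaging operators in `𝒟(0, 0, c_Q)` (+ for sequence 2 the trace
  factorization `∂* = Tr·∇`, `opDec_DtG_of_trace`) ⇒ the bundle, with an explicit common constant;
* §6 `geo_core_diff_entry_of_parts`: the conclusion in the geometric frame (rate `(δ − 160α′δ₁)/2`, constant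
  `22θ(max(1,c₁,c₂)·L⁸·K(8α′δ₁))¹⁵`, depths = distances to the cut zone).

## WHAT IS NOT CLAIMED (ABSOLUTE RULE)

Corollary 3.6 / Theorems 3.1–3.3 are NOT asserted: they enter as the hypothesis `B9.Thms31to33IneqAt …` per
sequence and configuration (their status is the cell's record on B9).  No concrete lattice operator is asserted to be
realized by a kernel family or a site kernel (`Realizes`, `RealizesKer` are hypotheses an instance proves from its
definitions), the position maps with scale preservation and distance comparison are hypotheses (the comparison of
`d_□` with `d` is the business of the cell's `B9SectCDistCompare`, not imported here), the (L) bundle and the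
averaging-operator classes are hypotheses with their constructors in `…B9SectCDiffDict`, and `∂* = Tr·∇` is a
model identity supplied as the hypothesis `hTr`.  What remains hypothesised, field by field, is listed in the cell
record `b2b-balaban-r1/SectC-inst-census.md`.  Value = kernel-certified bookkeeping, NOT summit progress.
-/

namespace Literature.MathematicalPhysics.QuantumFieldTheory.Balaban1983to89.B9SectCDiffAssembly

open Finset Real
open B4Sect5Torus (IsPseudoDist)
open B6DomainChange (Profile IsDepth)
open B9SectCDiffEstimate
open B9SectCDiffDict

/-! ## §1 Closure: constant monotonicity and left multiplication by a LOCAL operator -/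

section Closure

variable {S : Type*} {F : Frame S}
variable {u v w U V W : Type*} [Fintype u] [Fintype v] [Fintype U] [DecidableEq U] [DecidableEq V]
variable {bu : u → U} {bv : v → V} {bw : w → W} {pU : U → S} {pV : V → S} {pW : W → S}

omit [Fintype u] [Fintype U] [DecidableEq U] in
/-- the class `𝒟(n, k, c)` is monotone in the constant: `c ≤ c′` (for `0 ≤ c`). [folklore] -/
theorem opDec_mono (hF : F.Valid) {n : ℕ} {k : ℤ} {c c' : ℝ} {T : Matrix u v ℝ}
    (h : OpDec F bu bv pU pV n k c T) (hc0 : 0 ≤ c) (hc : c ≤ c') : OpDec F bu bv pU pV n k c' T := by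
  obtain ⟨K, hB, hW⟩ := h
  exact ⟨K, hB, hW.mono hF.hρ (fun a => hF.sc_zpow_nonneg k a) hc0 hc le_rfl⟩

/-- **left multiplication by a LOCAL operator preserves `𝒟(n, k, ·)` up to the constant**: if `Tl` has a block
majorant `Kl ≥ 0` whose rows sum to `≤ m` and whose support has block range `≤ r` (`Kl I′ I ≠ 0 ⇒ ρ(I′, I) ≤ r`),
and `T ∈ 𝒟(n, k, c)` (`|k| ≤ 8`, rate `δ₀ − nu ≥ 0`), then `Tl·T ∈ 𝒟(n, k, m·Λ·e^{(u + δ₀ − nu)r}·c)`: the scale weight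
is moved from the inner block to the outer row by one transfer ((2.60) of [4] p. 234, cost `Λe^{uρ}`) and the decay
by the triangle inequality (cost `e^{(δ₀−nu)ρ}`), `ρ ≤ r` (B9 p. 398: *"Using Lemma 2.1 in [4] we may replace the
factor (L^jη)^α by (L^jη)^β(L^{j′}η)^γ with β + γ = α, j, j′ are indices of localizations"*).  Used for `∂*G =
Tr·(∇G)` (the divergence of a 1-form is a local signed trace of its covariant derivative) and for any fine local
factor standing LEFT of a (3.42)-operator. [cite: Balaban1984PropagatorsII, (2.60) p.234] -/
theorem OpDec.lmul_local (hF : F.Valid) {n : ℕ} {k : ℤ} (hk : -8 ≤ k) (hk' : k ≤ 8) (hn : 0 ≤ F.rate n)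
    {c m r : ℝ} (hc : 0 ≤ c) {Tl : Matrix w u ℝ} {Kl : Matrix W U ℝ} {T : Matrix u v ℝ}
    (hBl : BlkMaj bw bu Tl Kl) (hm : ∀ I', ∑ I, Kl I' I ≤ m)
    (hfar : ∀ I' I, Kl I' I ≠ 0 → F.ρ (pW I') (pU I) ≤ r) (h : OpDec F bu bv pU pV n k c T) :
    OpDec F bw bv pW pV n k (m * (F.Λ * Real.exp ((F.u + F.rate n) * r)) * c) (Tl * T) := by
  obtain ⟨K, hB, hW⟩ := h
  refine ⟨Kl * K, hBl.mul hB, fun I' J => ?_⟩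
  -- the common outer bound
  set Bd : ℝ := c * (F.Λ * Real.exp ((F.u + F.rate n) * r)) * F.sc (pW I') ^ k *
    Real.exp (-(F.rate n * F.ρ (pW I') (pV J))) with hBd
  have hBd0 : 0 ≤ Bd := by
    rw [hBd]
    exact mul_nonneg (mul_nonneg (mul_nonneg hc (mul_nonneg hF.Λ_nonneg (Real.exp_nonneg _)))
      (hF.sc_zpow_nonneg k _)) (Real.exp_nonneg _)
  -- pointwise: Kl I' I * K I J ≤ Kl I' I * Bd
  have hpt : ∀ I, Kl I' I * K I J ≤ Kl I' I * Bd := by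
    intro I
    by_cases h0 : Kl I' I = 0
    · rw [h0, zero_mul, zero_mul]
    refine mul_le_mul_of_nonneg_left ?_ (hBl.nonneg I' I)
    have hρ := hfar I' I h0
    have hKIJ := (le_abs_self (K I J)).trans (hW I J)
    refine hKIJ.trans ?_
    -- transfer of the scale weight: sc(pU I)^k ≤ Λ sc(pW I')^k e^{u ρ(pW I', pU I)} ≤ Λ e^{u r} sc(pW I')^k
    have htr : F.sc (pU I) ^ k ≤ F.Λ * F.sc (pW I') ^ k * Real.exp (F.u * r) := by
      have h1 := hF.htr k hk hk' (pW I') (pU I)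
      refine h1.trans (mul_le_mul_of_nonneg_left (Real.exp_le_exp.mpr ?_)
        (mul_nonneg hF.Λ_nonneg (hF.sc_zpow_nonneg k _)))
      exact mul_le_mul_of_nonneg_left hρ hF.hu.le
    -- triangle inequality: e^{-rate ρ(pU I, pV J)} ≤ e^{rate r} e^{-rate ρ(pW I', pV J)}
    have htri : Real.exp (-(F.rate n * F.ρ (pU I) (pV J))) ≤
        Real.exp (F.rate n * r) * Real.exp (-(F.rate n * F.ρ (pW I') (pV J))) := by
      rw [← Real.exp_add]
      refine Real.exp_le_exp.mpr ?_
      have ht := hF.hρ.triangle (pW I') (pU I) (pV J)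
      nlinarith [hF.hρ.nonneg (pU I) (pV J)]
    calc c * F.sc (pU I) ^ k * Real.exp (-(F.rate n * F.ρ (pU I) (pV J)))
        ≤ c * (F.Λ * F.sc (pW I') ^ k * Real.exp (F.u * r)) *
            (Real.exp (F.rate n * r) * Real.exp (-(F.rate n * F.ρ (pW I') (pV J)))) :=
          mul_le_mul (mul_le_mul_of_nonneg_left htr hc) htri (Real.exp_nonneg _)
            (mul_nonneg hc (mul_nonneg (mul_nonneg hF.Λ_nonneg (hF.sc_zpow_nonneg k _)) (Real.exp_nonneg _)))
      _ = Bd := by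
          rw [hBd, add_mul, Real.exp_add]; ring
  rw [Matrix.mul_apply, abs_of_nonneg (sum_nonneg fun I _ => mul_nonneg (hBl.nonneg I' I) (hB.nonneg I J))]
  calc ∑ I, Kl I' I * K I J ≤ ∑ I, Kl I' I * Bd := sum_le_sum fun I _ => hpt I
    _ = (∑ I, Kl I' I) * Bd := by rw [sum_mul]
    _ ≤ m * Bd := mul_le_mul_of_nonneg_right (hm I') hBd0
    _ = m * (F.Λ * Real.exp ((F.u + F.rate n) * r)) * c * (fun a => F.sc a ^ k) (pW I') *
          Real.exp (-(F.rate n * F.ρ (pW I') (pV J))) := by rw [hBd]; ring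

end Closure

/-! ## §2 (3.42) ALONG A POSITION MAP `p : 𝔅(□) → S` -/

section Along

variable {g : B9.Geometry} {B : B9.Backgrounds} {S : Type*}
variable {u v : Type*} [Fintype v]

/-- a rate-weighted distance comparison from a plain one: `F.δ₀ ≤ δ₀`, `F.ρ(p y, p y′) ≤ d(y, y′)` (`F.δ₀ ≥ 0`,
`d ≥ 0`) give `F.δ₀·F.ρ(p y, p y′) ≤ δ₀·d(y, y′)`. [folklore] -/
theorem cmp_of_le (F : Frame S) {p : g.Site → S} {δ₀ : ℝ} (hδ : F.δ₀ ≤ δ₀) (hδ0 : 0 ≤ F.δ₀)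
    (hρ : ∀ y y', F.ρ (p y) (p y') ≤ g.dist y y') (hd : ∀ y y', 0 ≤ g.dist y y') (y y' : g.Site) :
    F.δ₀ * F.ρ (p y) (p y') ≤ δ₀ * g.dist y y' :=
  (mul_le_mul_of_nonneg_left (hρ y y') hδ0).trans (mul_le_mul_of_nonneg_right hδ (hd y y'))

/-- the (3.42) majorant transported along a position map `p : 𝔅(□) → S` that PRESERVES THE SCALE LENGTH
(`F.sc (p y) = Lʲη = g.len y`) and COMPARES THE DISTANCES at the frame's rate (`F.δ₀·F.ρ(p y, p y′) ≤ δ₀·d_□(y, y′)`)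
is row-weighted decay in the frame: weight `scᵏ`, constant `B₀`, rate `F.δ₀ = F.rate 0`.
[cite: Balaban1985BackgroundPropagators, (3.42) p.397] -/
theorem wdec_maj342_along (F : Frame S) {p : g.Site → S} {δ₀ B₀ : ℝ} (hB₀ : 0 ≤ B₀) (hlen : ∀ y, 0 ≤ g.len y)
    (hsc : ∀ y, F.sc (p y) = g.len y) (hcmp : ∀ y y', F.δ₀ * F.ρ (p y) (p y') ≤ δ₀ * g.dist y y') (n : Fin 4) :
    WDec F.ρ p p (fun a => F.sc a ^ kpow n) B₀ (F.rate 0) (maj342 g n B₀ δ₀) := by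
  intro y y'
  show _ ≤ B₀ * F.sc (p y) ^ kpow n * Real.exp (-(F.rate 0 * F.ρ (p y) (p y')))
  have h1 : |maj342 g n B₀ δ₀ y y'| = B₀ * g.len y ^ kpow n * Real.exp (-(δ₀ * g.dist y y')) := by
    rw [abs_of_nonneg (maj342_nonneg hB₀ hlen n δ₀ y y')]
    show B₀ * B9.pref4 (g.len y) n * _ = _
    rw [pref4_eq_zpow]
  rw [h1, F.rate_zero, hsc y]
  exact mul_le_mul_of_nonneg_left (Real.exp_le_exp.mpr (by linarith [hcmp y y']))
    (mul_nonneg hB₀ (zpow_nonneg (hlen y) _))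

/-- **(3.42) ⇒ HYPOTHESIS (M) ALONG A POSITION MAP**: in a frame `F` on `S`, for a local sequence with block
lattice `𝔅(□) = g.Site` placed in `S` by `p` (scale preserved, distances compared at the frame's rate), a matrix
realized by the n-th quantity of a kernel family satisfying (3.42) at `U` (the first conjunct of
`B9.Ineq342_346_347`, e.g. from Cor. 3.6's conclusion `B9.Thms31to33IneqAt`) is in `𝒟(0, k_n, B₀)` with positions
`p` — the form of the fields `mG`, `mG′`, `m∂G′`, `m∇G` of `EstHyp` for EACH of the two sequences in ONE frame
(`…B9SectCDiffDict.opDec_of_ineq342` is the case `S = 𝔅(□)`, `p = id`).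
[cite: Balaban1985BackgroundPropagators, (3.42) p.397 + Cor. 3.6 p.408] -/
theorem opDec_of_ineq342_along [DecidableEq g.Site] (F : Frame S) {p : g.Site → S} {δ₀ : ℝ}
    (hsc : ∀ y, F.sc (p y) = g.len y) (hcmp : ∀ y y', F.δ₀ * F.ρ (p y) (p y') ≤ δ₀ * g.dist y y')
    {K : B9.KernelFamily g B} {B₀ : ℝ} {U : B.Cfg} (hI : B9.Ineq342_346_347 K B₀ δ₀ U)
    {n : Fin 4} {bu : u → g.Site} {bv : v → g.Site} {T : Matrix u v ℝ} (hR : Realizes K n U bu bv T)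
    (hB₀ : 0 ≤ B₀) (hlen : ∀ y, 0 ≤ g.len y) :
    OpDec F bu bv p p 0 (kpow n) B₀ T :=
  OpDec.of_parts (blkMaj_of_ineq342 hI hR hB₀ hlen) (wdec_maj342_along F hB₀ hlen hsc hcmp n)

end Along

/-! ## §3 The (3.48) dictionary: `C = (Q′G′²Q′*)⁻¹ ∈ 𝒟(0, −4, κB₁)` -/

section Ker

variable {g : B9.Geometry} {B : B9.Backgrounds} {S : Type*}
variable {w w' : Type*} [Fintype w'] [DecidableEq g.Site]

/-- **REALIZATION of a coarse-lattice matrix by a site kernel** (hypothesis structure): the block row sums of `T`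
are dominated by the KERNEL times the COLUMN MEASURE WEIGHT `(L^{j′}η)^d` of the block lattice (times a
multiplicity `κ`, e.g. the number of internal 𝔤-indices per block): `Σ_{x′ ∈ block J} |T x x′| ≤ κ·(g.len J)^d·|C(U;
bw x, J)|`.  Reading (cell XREAD b09-g9 N1): in `TwoSeq` every operator is the matrix of its ACTION ON FUNCTIONS,
`(Cλ)(y) = Σ_{y′} T(y, y′)λ(y′)`, while (3.48) bounds the kernel with respect to the block-lattice measure,
`(Cλ)(y) = Σ_{y′} (L^{j′}η)^d C(y, y′)λ(y′)`; the weight `(L^{j′}η)^d` is what cancels (3.48)'s `(L^{j′}η)^{−d}`.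
OURS (typing). [cite: Balaban1985BackgroundPropagators, (3.48) p.398] -/
structure RealizesKer (Cv : B9.SiteKernel g B) (d : ℕ) (U : B.Cfg) (κ : ℝ) (bw : w → g.Site)
    (bw' : w' → g.Site) (T : Matrix w w' ℝ) : Prop where
  rowsum : ∀ (x : w) (J : g.Site),
    ∑ x' ∈ univ.filter (fun x' => bw' x' = J), |T x x'| ≤ κ * g.len J ^ d * |Cv.ker U (bw x) J|

/-- `t^d · t^{−(d:ℝ)} = 1` for `t > 0`. [folklore] -/
theorem pow_mul_rpow_neg_natCast {t : ℝ} (ht : 0 < t) (d : ℕ) : t ^ d * t ^ (-(d : ℝ)) = 1 := by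
  rw [Real.rpow_neg ht.le, Real.rpow_natCast, mul_inv_cancel₀ (pow_ne_zero d ht.ne')]

/-- `t^{−(4:ℝ)} = t^{(−4:ℤ)}`. [folklore] -/
theorem rpow_neg_four (t : ℝ) : t ^ (-(4 : ℝ)) = t ^ (-4 : ℤ) := by
  rw [← Real.rpow_intCast]; norm_num

/-- **(3.48) ⇒ HYPOTHESIS (M) for `C`, ALONG A POSITION MAP**: the printed *"|(Q′(U)G′²(U)Q′*(U))^{−1}(y, y′)| ≤
B₀(L^jη)^{−4}(L^{j′}η)^{−d}e^{−δ₀d(y,y′)}"* (the middle conjunct of `B9.Thms31to33IneqAt`, constants `(B₁, δ₁)`) and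
a realization of `T` by the kernel give `T ∈ 𝒟(0, −4, κB₁)` with positions `p` — the fields `mC₁`, `mC₂` of `EstHyp`
(`g.len > 0`: the real powers of the print are the integer powers of the class).
[cite: Balaban1985BackgroundPropagators, Thm 3.2 (3.48) p.398] -/
theorem opDec_of_ineq348_along (F : Frame S) {p : g.Site → S} {δ₁ : ℝ}
    (hsc : ∀ y, F.sc (p y) = g.len y) (hcmp : ∀ y y', F.δ₀ * F.ρ (p y) (p y') ≤ δ₁ * g.dist y y')
    {Cv : B9.SiteKernel g B} {B₁ : ℝ} {U : B.Cfg} {d : ℕ}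
    (h348 : ∀ y y' : g.Site, |Cv.ker U y y'| ≤
      B₁ * (g.len y) ^ (-(4 : ℝ)) * (g.len y') ^ (-(d : ℝ)) * Real.exp (-(δ₁ * g.dist y y')))
    {κ : ℝ} (hκ : 0 ≤ κ) {bw : w → g.Site} {bw' : w' → g.Site} {T : Matrix w w' ℝ}
    (hR : RealizesKer Cv d U κ bw bw' T) (hB₁ : 0 ≤ B₁) (hlen : ∀ y, 0 < g.len y) :
    OpDec F bw bw' p p 0 (-4) (κ * B₁) T := by
  -- the block majorant on 𝔅(□)
  set K : Matrix g.Site g.Site ℝ := fun I J => κ * B₁ * g.len I ^ (-4 : ℤ) * Real.exp (-(δ₁ * g.dist I J))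
    with hK
  have hK0 : ∀ I J, 0 ≤ K I J := fun I J =>
    mul_nonneg (mul_nonneg (mul_nonneg hκ hB₁) (zpow_nonneg (hlen I).le _)) (Real.exp_nonneg _)
  have hBM : BlkMaj bw bw' T K := by
    refine ⟨hK0, fun x J => (hR.rowsum x J).trans ?_⟩
    have h1 := h348 (bw x) J
    have hJd : 0 ≤ κ * g.len J ^ d := mul_nonneg hκ (pow_nonneg (hlen J).le d)
    calc κ * g.len J ^ d * |Cv.ker U (bw x) J|
        ≤ κ * g.len J ^ d * (B₁ * g.len (bw x) ^ (-(4 : ℝ)) * g.len J ^ (-(d : ℝ)) *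
            Real.exp (-(δ₁ * g.dist (bw x) J))) := mul_le_mul_of_nonneg_left h1 hJd
      _ = κ * B₁ * g.len (bw x) ^ (-(4 : ℝ)) * (g.len J ^ d * g.len J ^ (-(d : ℝ))) *
            Real.exp (-(δ₁ * g.dist (bw x) J)) := by ring
      _ = K (bw x) J := by rw [pow_mul_rpow_neg_natCast (hlen J), rpow_neg_four (g.len (bw x)), hK]; ring
  refine OpDec.of_parts hBM fun I J => ?_
  show _ ≤ κ * B₁ * F.sc (p I) ^ (-4 : ℤ) * Real.exp (-(F.rate 0 * F.ρ (p I) (p J)))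
  rw [abs_of_nonneg (hK0 I J), hK, F.rate_zero, hsc I]
  exact mul_le_mul_of_nonneg_left (Real.exp_le_exp.mpr (by linarith [hcmp I J]))
    (mul_nonneg (mul_nonneg hκ hB₁) (zpow_nonneg (hlen I).le _))

end Ker

/-! ## §4 Per-sequence (M) bundles, the (L) bundle, and the ASSEMBLER of `EstHyp` -/

section Bundles

open B9SectCDiffExpansion (TwoSeq)
open B9SectCDiff (cutX)

universe uu

variable {S : Type*}
variable {s b S₁ S₂ B₁ B₂ : Type uu} [Fintype s] [DecidableEq s] [Fintype b] [DecidableEq b]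
  [Fintype S₁] [DecidableEq S₁] [Fintype S₂] [DecidableEq S₂] [Fintype B₁] [Fintype B₂]
variable {t U₁ U₂ : Type uu} [Fintype t] [Fintype U₁] [DecidableEq U₁] [Fintype U₂] [DecidableEq U₂]

/-- **(M) of sequence 1 at constant `c`**: the seven one-sequence factors of sequence 1 in `TwoSeq.dT_flat`
(`Q₁, G₁, ∂G′₁, Q′*₁, C₁, Q′₁, G′₁`) in the classes `𝒟(0, k, c)` with the printed scale powers, over the block maps of
sequence 1 and positions `p₁` — the fields `mQ₁ … mG'₁` of `…B9SectCDiffEstimate.EstHyp`, separated so that they can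
be DISCHARGED PER SEQUENCE (`MOne.of_thms31to33`). OURS (typing). [cite: Balaban1985BackgroundPropagators, (3.42) + (3.48) pp.397–398] -/
structure MOne (F : Frame S) (X : TwoSeq s b S₁ S₂ B₁ B₂) (p₁ : U₁ → S) (bs₁ : s → U₁) (bb₁ : b → U₁)
    (bS₁ : S₁ → U₁) (bB₁ : B₁ → U₁) (c : ℝ) : Prop where
  mQ : OpDec F bB₁ bb₁ p₁ p₁ 0 0 c X.Q₁
  mG : OpDec F bb₁ bb₁ p₁ p₁ 0 2 c X.G₁
  mDG' : OpDec F bb₁ bs₁ p₁ p₁ 0 1 c (X.D * X.G'₁)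
  mQ't : OpDec F bs₁ bS₁ p₁ p₁ 0 0 c X.Q't₁
  mC : OpDec F bS₁ bS₁ p₁ p₁ 0 (-4) c X.C₁
  mQ' : OpDec F bS₁ bs₁ p₁ p₁ 0 0 c X.Q'₁
  mG' : OpDec F bs₁ bs₁ p₁ p₁ 0 2 c X.G'₁

/-- **(M) of sequence 2 at constant `c`**: the nine one-sequence factors of sequence 2 (`G₂, Q*₂, ∂*G₂, ∇G₂, G′₂,
∂G′₂, Q′*₂, C₂, Q′₂`), with the covariant derivative `Dv` of 1-forms (2-tensor carrier `t`) — the fields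
`mG₂ … mQ'₂` of `EstHyp`. OURS (typing). [cite: Balaban1985BackgroundPropagators, (3.42) + (3.48) + Thm 3.3 pp.397–399] -/
structure MTwo (F : Frame S) (X : TwoSeq s b S₁ S₂ B₁ B₂) (p₂ : U₂ → S) (bs₂ : s → U₂) (bb₂ : b → U₂)
    (bt₂ : t → U₂) (bS₂ : S₂ → U₂) (bB₂ : B₂ → U₂) (Dv : Matrix t b ℝ) (c : ℝ) : Prop where
  mG : OpDec F bb₂ bb₂ p₂ p₂ 0 2 c X.G₂
  mQt : OpDec F bb₂ bB₂ p₂ p₂ 0 0 c X.Qt₂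
  mDtG : OpDec F bs₂ bb₂ p₂ p₂ 0 1 c (X.Dt * X.G₂)
  mDvG : OpDec F bt₂ bb₂ p₂ p₂ 0 1 c (Dv * X.G₂)
  mG' : OpDec F bs₂ bs₂ p₂ p₂ 0 2 c X.G'₂
  mDG' : OpDec F bb₂ bs₂ p₂ p₂ 0 1 c (X.D * X.G'₂)
  mQ't : OpDec F bs₂ bS₂ p₂ p₂ 0 0 c X.Q't₂
  mC : OpDec F bS₂ bS₂ p₂ p₂ 0 (-4) c X.C₂
  mQ' : OpDec F bS₂ bs₂ p₂ p₂ 0 0 c X.Q'₂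

variable {F : Frame S} {X : TwoSeq s b S₁ S₂ B₁ B₂}
variable {p₁ : U₁ → S} {p₂ : U₂ → S} {bs₁ : s → U₁} {bb₁ : b → U₁} {bS₁ : S₁ → U₁} {bB₁ : B₁ → U₁}
  {bs₂ : s → U₂} {bb₂ : b → U₂} {bt₂ : t → U₂} {bS₂ : S₂ → U₂} {bB₂ : B₂ → U₂} {Dv : Matrix t b ℝ}

omit [Fintype U₁] in
/-- constant monotonicity of the bundle. [folklore] -/
theorem MOne.mono (hF : F.Valid) {c c' : ℝ} (h : MOne F X p₁ bs₁ bb₁ bS₁ bB₁ c) (hc0 : 0 ≤ c) (hc : c ≤ c') :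
    MOne F X p₁ bs₁ bb₁ bS₁ bB₁ c' where
  mQ := opDec_mono hF h.mQ hc0 hc
  mG := opDec_mono hF h.mG hc0 hc
  mDG' := opDec_mono hF h.mDG' hc0 hc
  mQ't := opDec_mono hF h.mQ't hc0 hc
  mC := opDec_mono hF h.mC hc0 hc
  mQ' := opDec_mono hF h.mQ' hc0 hc
  mG' := opDec_mono hF h.mG' hc0 hc

omit [Fintype t] [Fintype U₂] in
/-- constant monotonicity of the bundle. [folklore] -/
theorem MTwo.mono (hF : F.Valid) {c c' : ℝ} (h : MTwo F X p₂ bs₂ bb₂ bt₂ bS₂ bB₂ Dv c) (hc0 : 0 ≤ c)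
    (hc : c ≤ c') : MTwo F X p₂ bs₂ bb₂ bt₂ bS₂ bB₂ Dv c' where
  mG := opDec_mono hF h.mG hc0 hc
  mQt := opDec_mono hF h.mQt hc0 hc
  mDtG := opDec_mono hF h.mDtG hc0 hc
  mDvG := opDec_mono hF h.mDvG hc0 hc
  mG' := opDec_mono hF h.mG' hc0 hc
  mDG' := opDec_mono hF h.mDG' hc0 hc
  mQ't := opDec_mono hF h.mQ't hc0 hc
  mC := opDec_mono hF h.mC hc0 hc
  mQ' := opDec_mono hF h.mQ' hc0 hc

/-- **(L) at constant `θ`**: the seven multiplication-type local defects in the zone classes `𝒵(k, θ)` and the three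
ONE-SIDED FORMS `𝔇(Λ) = Lm₁·∇ + Lm₀`, `∂·𝔇(∂*) = Dm₁·∇ + Dm₀`, `𝔇(Δ′_a) = Am₁·∂ + Am₀` with their coefficient
operators (data) in `𝒵(−1, θ)` / `𝒵(−2, θ)` — the fields `zQ … zAm₀` of `EstHyp` (p. 414: *"They are of the order
O(M⁻¹), or O(M⁻²), if considered on a proper scale"*).  OURS (typing); every field remains a HYPOTHESIS on the
concrete lattice operators (constructors: `…B9SectCDiffDict.opZon_of_cut`, `opZon_of_local`, `opZon_add`).
[cite: Balaban1985BackgroundPropagators, (3.100) p.413 + p.414] -/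
structure LDat (F : Frame S) (X : TwoSeq s b S₁ S₂ B₁ B₂) (p₁ : U₁ → S) (p₂ : U₂ → S) (bs₁ : s → U₁)
    (bb₁ : b → U₁) (bS₁ : S₁ → U₁) (bB₁ : B₁ → U₁) (bs₂ : s → U₂) (bb₂ : b → U₂) (bt₂ : t → U₂)
    (bS₂ : S₂ → U₂) (bB₂ : B₂ → U₂) (Dv : Matrix t b ℝ) (θ : ℝ) where
  /-- one-sided form of 𝔇(Λ): first-order coefficient -/
  Lm₁ : Matrix b t ℝ
  /-- one-sided form of 𝔇(Λ): zeroth-order coefficient -/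
  Lm₀ : Matrix b b ℝ
  /-- one-sided form of ∂·𝔇(∂*): first-order coefficient -/
  Dm₁ : Matrix b t ℝ
  /-- one-sided form of ∂·𝔇(∂*): zeroth-order coefficient -/
  Dm₀ : Matrix b b ℝ
  /-- one-sided form of 𝔇(Δ′_a): first-order coefficient -/
  Am₁ : Matrix s b ℝ
  /-- one-sided form of 𝔇(Δ′_a): zeroth-order coefficient -/
  Am₀ : Matrix s s ℝ
  zQ : OpZon F bB₁ bb₂ p₁ p₂ 0 θ X.dQ
  zQt : OpZon F bb₁ bB₂ p₁ p₂ 0 θ X.dQt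
  zD : OpZon F bb₁ bs₂ p₁ p₂ (-1) θ X.dD
  zDt : OpZon F bs₁ bb₂ p₁ p₂ (-1) θ X.dDt
  zA : OpZon F bb₁ bb₂ p₁ p₂ (-2) θ X.dA
  zQ' : OpZon F bS₁ bs₂ p₁ p₂ 0 θ X.dQ'
  zQ't : OpZon F bs₁ bS₂ p₁ p₂ 0 θ X.dQ't
  hΛ : X.dΛ = Lm₁ * Dv + Lm₀
  zLm₁ : OpZon F bb₁ bt₂ p₁ p₂ (-1) θ Lm₁
  zLm₀ : OpZon F bb₁ bb₂ p₁ p₂ (-2) θ Lm₀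
  hM : X.D * X.dDt = Dm₁ * Dv + Dm₀
  zDm₁ : OpZon F bb₁ bt₂ p₁ p₂ (-1) θ Dm₁
  zDm₀ : OpZon F bb₁ bb₂ p₁ p₂ (-2) θ Dm₀
  hA : X.ddA' = Am₁ * X.D + Am₀
  zAm₁ : OpZon F bs₁ bb₂ p₁ p₂ (-1) θ Am₁
  zAm₀ : OpZon F bs₁ bs₂ p₁ p₂ (-2) θ Am₀

/-- **THE ASSEMBLER**: (M) of sequence 1 at `c₁`, (M) of sequence 2 at `c₂`, (L) at `θ` and the two profiles (P)
give `EstHyp F X t U₁ U₂` with the common constant `c = max(1, c₁, c₂)` (monotonicity of `𝒟` in the constant) and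
`θ`.  OURS (bookkeeping). [cite: Balaban1985BackgroundPropagators, (3.97) p.412] -/
noncomputable def assemble (hF : F.Valid) {c₁ c₂ θ : ℝ} (m₁ : MOne F X p₁ bs₁ bb₁ bS₁ bB₁ c₁)
    (m₂ : MTwo F X p₂ bs₂ bb₂ bt₂ bS₂ bB₂ Dv c₂)
    (L : LDat F X p₁ p₂ bs₁ bb₁ bS₁ bB₁ bs₂ bb₂ bt₂ bS₂ bB₂ Dv θ) (hc₁ : 0 ≤ c₁) (hc₂ : 0 ≤ c₂) (hθ : 0 ≤ θ)
    (hP₁ : Profile F.ρ p₁ F.K) (hP₂ : Profile F.ρ p₂ F.K) : EstHyp F X t U₁ U₂ :=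
  have h₁ : MOne F X p₁ bs₁ bb₁ bS₁ bB₁ (max 1 (max c₁ c₂)) :=
    m₁.mono hF hc₁ ((le_max_left _ _).trans (le_max_right _ _))
  have h₂ : MTwo F X p₂ bs₂ bb₂ bt₂ bS₂ bB₂ Dv (max 1 (max c₁ c₂)) :=
    m₂.mono hF hc₂ ((le_max_right _ _).trans (le_max_right _ _))
  { p₁ := p₁, p₂ := p₂, bs₁ := bs₁, bs₂ := bs₂, bb₁ := bb₁, bb₂ := bb₂, bt₂ := bt₂, bS₁ := bS₁, bS₂ := bS₂,
    bB₁ := bB₁, bB₂ := bB₂, Dv := Dv, Lm₁ := L.Lm₁, Lm₀ := L.Lm₀, Dm₁ := L.Dm₁, Dm₀ := L.Dm₀, Am₁ := L.Am₁,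
    Am₀ := L.Am₀, c := max 1 (max c₁ c₂), θ := θ, hc := le_max_left _ _, hθ := hθ, hP₁ := hP₁, hP₂ := hP₂,
    mQ₁ := h₁.mQ, mG₁ := h₁.mG, mDG'₁ := h₁.mDG', mQ't₁ := h₁.mQ't, mC₁ := h₁.mC, mQ'₁ := h₁.mQ', mG'₁ := h₁.mG',
    mG₂ := h₂.mG, mQt₂ := h₂.mQt, mDtG₂ := h₂.mDtG, mDvG₂ := h₂.mDvG, mG'₂ := h₂.mG', mDG'₂ := h₂.mDG',
    mQ't₂ := h₂.mQ't, mC₂ := h₂.mC, mQ'₂ := h₂.mQ',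
    zQ := L.zQ, zQt := L.zQt, zD := L.zD, zDt := L.zDt, zA := L.zA, zQ' := L.zQ', zQ't := L.zQ't,
    hΛ := L.hΛ, zLm₁ := L.zLm₁, zLm₀ := L.zLm₀, hM := L.hM, zDm₁ := L.zDm₁, zDm₀ := L.zDm₀, hA := L.hA,
    zAm₁ := L.zAm₁, zAm₀ := L.zAm₀ }

/-- [folklore] -/
theorem assemble_c (hF : F.Valid) {c₁ c₂ θ : ℝ} (m₁ : MOne F X p₁ bs₁ bb₁ bS₁ bB₁ c₁)
    (m₂ : MTwo F X p₂ bs₂ bb₂ bt₂ bS₂ bB₂ Dv c₂) (L : LDat F X p₁ p₂ bs₁ bb₁ bS₁ bB₁ bs₂ bb₂ bt₂ bS₂ bB₂ Dv θ)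
    (hc₁ : 0 ≤ c₁) (hc₂ : 0 ≤ c₂) (hθ : 0 ≤ θ) (hP₁ : Profile F.ρ p₁ F.K) (hP₂ : Profile F.ρ p₂ F.K) :
    (assemble hF m₁ m₂ L hc₁ hc₂ hθ hP₁ hP₂).c = max 1 (max c₁ c₂) := rfl

/-- **THEOREM D's conclusion from the parts**: (M) per sequence, (L), (P) ⇒ on the core of a common window the
difference of the two minimal propagators `(Q₁G₁Q*₁)(a, v) − (Q₂G₂Q*₂)(a, v)` has the (1.12)-shape with constant
`22θ(max(1,c₁,c₂)·Λ·K(u))¹⁵`, scale power 2, rate `σ = (δ₀ − 20u)/2` and the depths of both blocks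
(`EstHyp.core_diff_entry` on `assemble`).  OURS. [cite: Balaban1985BackgroundPropagators, (3.97) p.412] -/
theorem core_diff_entry_of_parts [DecidableEq B₁] [DecidableEq B₂] (hF : F.Valid) {c₁ c₂ θ : ℝ}
    (m₁ : MOne F X p₁ bs₁ bb₁ bS₁ bB₁ c₁) (m₂ : MTwo F X p₂ bs₂ bb₂ bt₂ bS₂ bB₂ Dv c₂)
    (L : LDat F X p₁ p₂ bs₁ bb₁ bS₁ bB₁ bs₂ bb₂ bt₂ bS₂ bB₂ Dv θ) (hc₁ : 0 ≤ c₁) (hc₂ : 0 ≤ c₂) (hθ : 0 ≤ θ)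
    (hP₁ : Profile F.ρ p₁ F.K) (hP₂ : Profile F.ρ p₂ F.K)
    {mB : Type uu} [Fintype mB] {f₁ : mB → B₁} {f₂ : mB → B₂} (hf₁ : Function.Injective f₁)
    (hf₂ : Function.Injective f₂) {ψ : mB → ℝ} (hψ : X.ψB = cutX f₁ f₂ ψ) {a v : mB} (ha : ψ a = 1)
    (hv : ψ v = 1) :
    |X.T₁ (f₁ a) (f₁ v) - X.T₂ (f₂ a) (f₂ v)| ≤ 22 * θ * (max 1 (max c₁ c₂) * F.Λ * F.K F.u) ^ 15 *
      F.sc (p₁ (bB₁ (f₁ a))) ^ (2 : ℤ) * Real.exp (-(F.σ * (F.ρ (p₁ (bB₁ (f₁ a))) (p₂ (bB₂ (f₂ v)))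
        + F.β (p₁ (bB₁ (f₁ a))) + F.β (p₂ (bB₂ (f₂ v)))))) :=
  (assemble hF m₁ m₂ L hc₁ hc₂ hθ hP₁ hP₂).core_diff_entry hF hf₁ hf₂ hψ ha hv

/-- **The E-twin from the parts** (v1.1): (M) per sequence, (L), (P) ⇒ on the core of a common window of 𝔅-sites the
difference of the two coarse operators `E = Q′G′²Q′*` of (3.97), `E₁(a, v) − E₂(a, v)`, has the (1.12)-shape with
constant `6θ(max(1,c₁,c₂)·Λ·K(u))¹⁵`, scale power 4, rate `σ` and the depths of both blocks (`EstHyp.core_dE_entry` on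
`assemble`).  OURS. [cite: Balaban1985BackgroundPropagators, (3.97) p.412] -/
theorem core_dE_entry_of_parts (hF : F.Valid) {c₁ c₂ θ : ℝ} (m₁ : MOne F X p₁ bs₁ bb₁ bS₁ bB₁ c₁)
    (m₂ : MTwo F X p₂ bs₂ bb₂ bt₂ bS₂ bB₂ Dv c₂) (L : LDat F X p₁ p₂ bs₁ bb₁ bS₁ bB₁ bs₂ bb₂ bt₂ bS₂ bB₂ Dv θ)
    (hc₁ : 0 ≤ c₁) (hc₂ : 0 ≤ c₂) (hθ : 0 ≤ θ) (hP₁ : Profile F.ρ p₁ F.K) (hP₂ : Profile F.ρ p₂ F.K)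
    {mS : Type uu} [Fintype mS] {f₁ : mS → S₁} {f₂ : mS → S₂} (hf₁ : Function.Injective f₁)
    (hf₂ : Function.Injective f₂) {ψ : mS → ℝ} (hψ : X.ψS = cutX f₁ f₂ ψ) {a v : mS} (ha : ψ a = 1)
    (hv : ψ v = 1) :
    |X.E₁ (f₁ a) (f₁ v) - X.E₂ (f₂ a) (f₂ v)| ≤ 6 * θ * (max 1 (max c₁ c₂) * F.Λ * F.K F.u) ^ 15 *
      F.sc (p₁ (bS₁ (f₁ a))) ^ (4 : ℤ) * Real.exp (-(F.σ * (F.ρ (p₁ (bS₁ (f₁ a))) (p₂ (bS₂ (f₂ v)))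
        + F.β (p₁ (bS₁ (f₁ a))) + F.β (p₂ (bS₂ (f₂ v)))))) :=
  (assemble hF m₁ m₂ L hc₁ hc₂ hθ hP₁ hP₂).core_dE_entry hF hf₁ hf₂ hψ ha hv

end Bundles

/-! ## §5 (M) FROM THE PRINT: the typed conclusion of Corollary 3.6 per sequence ⇒ `MOne` / `MTwo` -/

section Printed

open B9SectCDiffExpansion (TwoSeq)
open B9SectCDiff (cutX)

variable {S : Type*}
variable {s b S₁ S₂ B₁ B₂ : Type} [Fintype s] [DecidableEq s] [Fintype b] [DecidableEq b]
  [Fintype S₁] [DecidableEq S₁] [Fintype S₂] [DecidableEq S₂] [Fintype B₁] [Fintype B₂]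
variable {t : Type} [Fintype t]
variable {g₁ g₂ : B9.Geometry} {Bg₁ Bg₂ : B9.Backgrounds} [Fintype g₁.Site] [DecidableEq g₁.Site]
  [Fintype g₂.Site] [DecidableEq g₂.Site]

/-- the frame's input rate is positive (`20u ≤ δ₀`, `u > 0`). [folklore] -/
theorem rate_zero_nonneg {F : Frame S} (hF : F.Valid) : 0 ≤ F.rate 0 := by
  rw [F.rate_zero]; have := hF.hδ₀; have := hF.hu; linarith

omit [Fintype g₁.Site] in
/-- **(M) OF SEQUENCE 1 FROM THE PRINT.**  INPUTS: a frame `F` on `S`; the block lattice `𝔅(□₁) = g₁.Site` of the first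
local sequence placed by `p₁` (scale preserved; distances compared at the frame's rate against BOTH printed rates
`δ₀` of (3.42) and `δ₁` of (3.48)); the typed conclusion of Corollary 3.6 for this sequence at `U`
(`B9.Thms31to33IneqAt`: *"Theorems 3.1–3.3 hold for the operators G′(U), (Q′(U)G′²(U)Q′*(U))^{−1}, G(U) constructed
for the sequence {Ω′_j}"*, p. 408 — a HYPOTHESIS here); realizations of `G′₁`, `∂G′₁`, `G₁` by the entries 0, 1, 0 of the
kernel families `Gp`, `GA` (Thm 3.3: *"with G′(U) replaced by G(U) and λ replaced by a function J defined at bonds"*)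
and of `C₁` by the kernel `Cinv` (multiplicity `κ`); the three averaging operators `Q₁, Q′*₁, Q′₁` in `𝒟(0, 0, c_Q)`
(local operators: `…B9SectCDiffDict.opDec_of_local` / `opDec_of_rowsum_local`).  OUTPUT: `MOne` at
`c = max(A₀, κA₁, c_Q)`. [cite: Balaban1985BackgroundPropagators, Cor. 3.6 p.408 + (3.42) p.397 + (3.48) p.398 + Thm 3.3 p.399] -/
theorem MOne.of_thms31to33 (F : Frame S) (hF : F.Valid) (X : TwoSeq s b S₁ S₂ B₁ B₂) {p₁ : g₁.Site → S}
    {δ₀ δ₁ : ℝ} (hsc : ∀ y, F.sc (p₁ y) = g₁.len y)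
    (hcmp₀ : ∀ y y', F.δ₀ * F.ρ (p₁ y) (p₁ y') ≤ δ₀ * g₁.dist y y')
    (hcmp₁ : ∀ y y', F.δ₀ * F.ρ (p₁ y) (p₁ y') ≤ δ₁ * g₁.dist y y')
    {d : ℕ} {Gp GA : B9.KernelFamily g₁ Bg₁} {Cinv : B9.SiteKernel g₁ Bg₁} {A₀ A₁ : ℝ} {Bβ Bε : ℝ → ℝ}
    {Bεβ : ℝ → ℝ → ℝ} {U : Bg₁.Cfg} (hAt : B9.Thms31to33IneqAt d Gp GA Cinv A₀ δ₀ Bβ Bε Bεβ A₁ δ₁ U)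
    (hA₀ : 0 ≤ A₀) (hA₁ : 0 ≤ A₁) (hlen : ∀ y, 0 < g₁.len y)
    {bs₁ : s → g₁.Site} {bb₁ : b → g₁.Site} {bS₁ : S₁ → g₁.Site} {bB₁ : B₁ → g₁.Site}
    (rG' : Realizes Gp 0 U bs₁ bs₁ X.G'₁) (rDG' : Realizes Gp 1 U bb₁ bs₁ (X.D * X.G'₁))
    (rG : Realizes GA 0 U bb₁ bb₁ X.G₁) {κ : ℝ} (hκ : 0 ≤ κ) (rC : RealizesKer Cinv d U κ bS₁ bS₁ X.C₁)
    {cQ : ℝ} (hcQ : 0 ≤ cQ) (mQ : OpDec F bB₁ bb₁ p₁ p₁ 0 0 cQ X.Q₁) (mQ't : OpDec F bs₁ bS₁ p₁ p₁ 0 0 cQ X.Q't₁)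
    (mQ' : OpDec F bS₁ bs₁ p₁ p₁ 0 0 cQ X.Q'₁) :
    MOne F X p₁ bs₁ bb₁ bS₁ bB₁ (max (max A₀ (κ * A₁)) cQ) := by
  have hlen' : ∀ y, 0 ≤ g₁.len y := fun y => (hlen y).le
  have h0c : A₀ ≤ max (max A₀ (κ * A₁)) cQ := (le_max_left _ _).trans (le_max_left _ _)
  have h1c : κ * A₁ ≤ max (max A₀ (κ * A₁)) cQ := (le_max_right _ _).trans (le_max_left _ _)
  have hQc : cQ ≤ max (max A₀ (κ * A₁)) cQ := le_max_right _ _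
  have hG' := opDec_of_ineq342_along F hsc hcmp₀ hAt.1.1 rG' hA₀ hlen'
  have hDG' := opDec_of_ineq342_along F hsc hcmp₀ hAt.1.1 rDG' hA₀ hlen'
  have hG := opDec_of_ineq342_along F hsc hcmp₀ hAt.2.2.1 rG hA₀ hlen'
  have hC := opDec_of_ineq348_along F hsc hcmp₁ hAt.2.1 hκ rC hA₁ hlen
  exact
    { mQ := opDec_mono hF mQ hcQ hQc
      mG := opDec_mono hF (hG.castK kpow_vals.1) hA₀ h0c
      mDG' := opDec_mono hF (hDG'.castK kpow_vals.2.1) hA₀ h0c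
      mQ't := opDec_mono hF mQ't hcQ hQc
      mC := opDec_mono hF hC (mul_nonneg hκ hA₁) h1c
      mQ' := opDec_mono hF mQ' hcQ hQc
      mG' := opDec_mono hF (hG'.castK kpow_vals.1) hA₀ h0c }

/-- **`∂*G` from `∇G` by a local signed trace.**  If the divergence matrix of the model factors as `∂* = Tr·∇`
(`X.Dt = Tr * Dv` — the PRINTED identity (3.8), p. 392: *"(D*A)(x) = Σ_{μ=1}^{d} η^{−1}(R(U(x, x − ηe_μ))A(x − ηe_μ, x)
− A(x, x + ηe_μ)) = Σ_{μ=1}^{d} (D*_μ A_μ)(x) = Σ_{μ=1}^{d} (DA_μ)(x, x − ηe_μ)"*, so `Tr` has `≤ d` isometric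
𝔤-blocks per row and block range `≤ 1` — supplied as a HYPOTHESIS on the model, with row-sum bound `m` and block
range `r` of a majorant `Kl` of `Tr`), then `∇G ∈ 𝒟(0, 1, A₀)` gives `∂*G ∈ 𝒟(0, 1, m·Λ·e^{(u+δ₀)r}·A₀)`
(`OpDec.lmul_local`). [cite: Balaban1985BackgroundPropagators, (3.8) p.392 + Thm 3.3 p.399] -/
theorem opDec_DtG_of_trace (F : Frame S) (hF : F.Valid) (X : TwoSeq s b S₁ S₂ B₁ B₂) {p₂ : g₂.Site → S}
    {bs₂ : s → g₂.Site} {bb₂ : b → g₂.Site} {bt₂ : t → g₂.Site} {Dv : Matrix t b ℝ} {A₀ : ℝ} (hA₀ : 0 ≤ A₀)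
    (hDvG : OpDec F bt₂ bb₂ p₂ p₂ 0 1 A₀ (Dv * X.G₂)) {Tr : Matrix s t ℝ} {Kl : Matrix g₂.Site g₂.Site ℝ}
    {m r : ℝ} (hTr : X.Dt = Tr * Dv) (hBl : BlkMaj bs₂ bt₂ Tr Kl) (hm : ∀ I', ∑ I, Kl I' I ≤ m)
    (hfar : ∀ I' I, Kl I' I ≠ 0 → F.ρ (p₂ I') (p₂ I) ≤ r) :
    OpDec F bs₂ bb₂ p₂ p₂ 0 1 (m * (F.Λ * Real.exp ((F.u + F.δ₀) * r)) * A₀) (X.Dt * X.G₂) := by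
  have h := OpDec.lmul_local hF (k := 1) (by norm_num) (by norm_num) (rate_zero_nonneg hF) hA₀ hBl hm hfar hDvG
  rw [F.rate_zero] at h
  rw [hTr, Matrix.mul_assoc]
  exact h

/-- **(M) OF SEQUENCE 2 FROM THE PRINT** (as `MOne.of_thms31to33`, for the second local sequence on `𝔅(□₂) =
g₂.Site` placed by `p₂`): additionally the realization of `∇G₂ = Dv·G₂` by entry 1 of `GA` (Thm 3.3) and the trace
factorization `∂* = Tr·∇` of `opDec_DtG_of_trace`; the averaging operators `Q*₂, Q′*₂, Q′₂` in `𝒟(0, 0, c_Q)`.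
OUTPUT: `MTwo` at `c = max(max(A₀, κA₁, c_Q), m·Λ·e^{(u+δ₀)r}·A₀)`.
[cite: Balaban1985BackgroundPropagators, Cor. 3.6 p.408 + (3.42) p.397 + (3.48) p.398 + Thm 3.3 p.399] -/
theorem MTwo.of_thms31to33 (F : Frame S) (hF : F.Valid) (X : TwoSeq s b S₁ S₂ B₁ B₂) {p₂ : g₂.Site → S}
    {δ₀ δ₁ : ℝ} (hsc : ∀ y, F.sc (p₂ y) = g₂.len y)
    (hcmp₀ : ∀ y y', F.δ₀ * F.ρ (p₂ y) (p₂ y') ≤ δ₀ * g₂.dist y y')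
    (hcmp₁ : ∀ y y', F.δ₀ * F.ρ (p₂ y) (p₂ y') ≤ δ₁ * g₂.dist y y')
    {d : ℕ} {Gp GA : B9.KernelFamily g₂ Bg₂} {Cinv : B9.SiteKernel g₂ Bg₂} {A₀ A₁ : ℝ} {Bβ Bε : ℝ → ℝ}
    {Bεβ : ℝ → ℝ → ℝ} {U : Bg₂.Cfg} (hAt : B9.Thms31to33IneqAt d Gp GA Cinv A₀ δ₀ Bβ Bε Bεβ A₁ δ₁ U)
    (hA₀ : 0 ≤ A₀) (hA₁ : 0 ≤ A₁) (hlen : ∀ y, 0 < g₂.len y)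
    {bs₂ : s → g₂.Site} {bb₂ : b → g₂.Site} {bt₂ : t → g₂.Site} {bS₂ : S₂ → g₂.Site} {bB₂ : B₂ → g₂.Site}
    {Dv : Matrix t b ℝ}
    (rG : Realizes GA 0 U bb₂ bb₂ X.G₂) (rDvG : Realizes GA 1 U bt₂ bb₂ (Dv * X.G₂))
    (rG' : Realizes Gp 0 U bs₂ bs₂ X.G'₂) (rDG' : Realizes Gp 1 U bb₂ bs₂ (X.D * X.G'₂))
    {κ : ℝ} (hκ : 0 ≤ κ) (rC : RealizesKer Cinv d U κ bS₂ bS₂ X.C₂)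
    {cQ : ℝ} (hcQ : 0 ≤ cQ) (mQt : OpDec F bb₂ bB₂ p₂ p₂ 0 0 cQ X.Qt₂) (mQ't : OpDec F bs₂ bS₂ p₂ p₂ 0 0 cQ X.Q't₂)
    (mQ' : OpDec F bS₂ bs₂ p₂ p₂ 0 0 cQ X.Q'₂)
    {Tr : Matrix s t ℝ} {Kl : Matrix g₂.Site g₂.Site ℝ} {m r : ℝ} (hm0 : 0 ≤ m) (hTr : X.Dt = Tr * Dv)
    (hBl : BlkMaj bs₂ bt₂ Tr Kl) (hm : ∀ I', ∑ I, Kl I' I ≤ m) (hfar : ∀ I' I, Kl I' I ≠ 0 → F.ρ (p₂ I') (p₂ I) ≤ r) :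
    MTwo F X p₂ bs₂ bb₂ bt₂ bS₂ bB₂ Dv
      (max (max (max A₀ (κ * A₁)) cQ) (m * (F.Λ * Real.exp ((F.u + F.δ₀) * r)) * A₀)) := by
  have hlen' : ∀ y, 0 ≤ g₂.len y := fun y => (hlen y).le
  set c := max (max (max A₀ (κ * A₁)) cQ) (m * (F.Λ * Real.exp ((F.u + F.δ₀) * r)) * A₀) with hc
  have h0c : A₀ ≤ c := ((le_max_left _ _).trans (le_max_left _ _)).trans (le_max_left _ _)
  have h1c : κ * A₁ ≤ c := ((le_max_right _ _).trans (le_max_left _ _)).trans (le_max_left _ _)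
  have hQc : cQ ≤ c := (le_max_right _ _).trans (le_max_left _ _)
  have hTc : m * (F.Λ * Real.exp ((F.u + F.δ₀) * r)) * A₀ ≤ c := le_max_right _ _
  have hT0 : 0 ≤ m * (F.Λ * Real.exp ((F.u + F.δ₀) * r)) * A₀ :=
    mul_nonneg (mul_nonneg hm0 (mul_nonneg hF.Λ_nonneg (Real.exp_nonneg _))) hA₀
  have hG := opDec_of_ineq342_along F hsc hcmp₀ hAt.2.2.1 rG hA₀ hlen'
  have hDvG := opDec_of_ineq342_along F hsc hcmp₀ hAt.2.2.1 rDvG hA₀ hlen'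
  have hG' := opDec_of_ineq342_along F hsc hcmp₀ hAt.1.1 rG' hA₀ hlen'
  have hDG' := opDec_of_ineq342_along F hsc hcmp₀ hAt.1.1 rDG' hA₀ hlen'
  have hC := opDec_of_ineq348_along F hsc hcmp₁ hAt.2.1 hκ rC hA₁ hlen
  have hDtG := opDec_DtG_of_trace F hF X hA₀ (hDvG.castK kpow_vals.2.1) hTr hBl hm hfar
  exact
    { mG := opDec_mono hF (hG.castK kpow_vals.1) hA₀ h0c
      mQt := opDec_mono hF mQt hcQ hQc
      mDtG := opDec_mono hF hDtG hT0 hTc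
      mDvG := opDec_mono hF (hDvG.castK kpow_vals.2.1) hA₀ h0c
      mG' := opDec_mono hF (hG'.castK kpow_vals.1) hA₀ h0c
      mDG' := opDec_mono hF (hDG'.castK kpow_vals.2.1) hA₀ h0c
      mQ't := opDec_mono hF mQ't hcQ hQc
      mC := opDec_mono hF hC (mul_nonneg hκ hA₁) h1c
      mQ' := opDec_mono hF mQ' hcQ hQc }

end Printed

/-! ## §6 The conclusion in the GEOMETRIC FRAME of `…B9SectCDiffFrame` (rate `(δ − 160α′δ₁)/2`, constant
`22θ(max(1,c₁,c₂)·L⁸·K(8α′δ₁))¹⁵`) -/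

section Geo

open B9SectCDiffExpansion (TwoSeq)
open B9SectCDiff (cutX)
open B6DomainMajorant
open B9SectCDiffFrame

universe uu

variable {g : B6.Geometry} {N : Finset g.Site} {hN : N.Nonempty} {c δ₁ α α' δ : ℝ}
variable {s b S₁ S₂ B₁ B₂ : Type uu} [Fintype s] [DecidableEq s] [Fintype b] [DecidableEq b]
  [Fintype S₁] [DecidableEq S₁] [Fintype S₂] [DecidableEq S₂] [Fintype B₁] [Fintype B₂]
variable {X : TwoSeq s b S₁ S₂ B₁ B₂}
variable {t U₁ U₂ : Type uu} [Fintype t] [Fintype U₁] [DecidableEq U₁] [Fintype U₂] [DecidableEq U₂]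
variable {p₁ : U₁ → g.Site} {p₂ : U₂ → g.Site} {bs₁ : s → U₁} {bb₁ : b → U₁} {bS₁ : S₁ → U₁} {bB₁ : B₁ → U₁}
  {bs₂ : s → U₂} {bb₂ : b → U₂} {bt₂ : t → U₂} {bS₂ : S₂ → U₂} {bB₂ : B₂ → U₂} {Dv : Matrix t b ℝ}

/-- **THEOREM D's conclusion from the parts, in the geometric frame** `geoFrame g N hN c δ₁ α α′ δ` (block distance
`d` of [4] (2.46), depth = distance to the cut zone `N`, profile `K(8α′δ₁) = max(c,1)` from (2.61), scale `Lʲη`,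
transfers `(L⁸, 8α′δ₁)` from (2.60); validity `geoFrame_valid` needs `160α′δ₁ ≤ δ`): rate `(δ − 160α′δ₁)/2`
(cell DIVERGENCE D-r1g11.1 vs the printed `2δ₀`).  OURS. [cite: Balaban1985BackgroundPropagators, (3.97) p.412] -/
theorem geo_core_diff_entry_of_parts [DecidableEq B₁] [DecidableEq B₂] (hF : (geoFrame g N hN c δ₁ α α' δ).Valid)
    {c₁ c₂ θ : ℝ} (m₁ : MOne (geoFrame g N hN c δ₁ α α' δ) X p₁ bs₁ bb₁ bS₁ bB₁ c₁)
    (m₂ : MTwo (geoFrame g N hN c δ₁ α α' δ) X p₂ bs₂ bb₂ bt₂ bS₂ bB₂ Dv c₂)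
    (L : LDat (geoFrame g N hN c δ₁ α α' δ) X p₁ p₂ bs₁ bb₁ bS₁ bB₁ bs₂ bb₂ bt₂ bS₂ bB₂ Dv θ) (hc₁ : 0 ≤ c₁)
    (hc₂ : 0 ≤ c₂) (hθ : 0 ≤ θ) (hP₁ : Profile g.dist p₁ (profileW g c δ₁ α))
    (hP₂ : Profile g.dist p₂ (profileW g c δ₁ α))
    {mB : Type uu} [Fintype mB] {f₁ : mB → B₁} {f₂ : mB → B₂} (hf₁ : Function.Injective f₁)
    (hf₂ : Function.Injective f₂) {ψ : mB → ℝ} (hψ : X.ψB = cutX f₁ f₂ ψ) {a v : mB} (ha : ψ a = 1)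
    (hv : ψ v = 1) :
    |X.T₁ (f₁ a) (f₁ v) - X.T₂ (f₂ a) (f₂ v)| ≤
      22 * θ * (max 1 (max c₁ c₂) * g.L ^ 8 * profileW g c δ₁ α (8 * (α' * δ₁))) ^ 15 *
        g.len (p₁ (bB₁ (f₁ a))) ^ (2 : ℤ) *
        Real.exp (-((δ - 160 * (α' * δ₁)) / 2 * (g.dist (p₁ (bB₁ (f₁ a))) (p₂ (bB₂ (f₂ v))) +
          zoneDepth g.dist N hN (p₁ (bB₁ (f₁ a))) + zoneDepth g.dist N hN (p₂ (bB₂ (f₂ v)))))) :=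
  geo_core_diff_entry hF (assemble hF m₁ m₂ L hc₁ hc₂ hθ hP₁ hP₂) hf₁ hf₂ hψ ha hv

end Geo

end Literature.MathematicalPhysics.QuantumFieldTheory.Balaban1983to89.B9SectCDiffAssembly
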